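import Mathlib
import HarnessLib
import Summits.ResolutionOfSingularities.ResolutionOfSingularities.Theorems.WildQuotientsWildQuotientResolutionS1aKillCertCover

/-!
# S1a — K AT AN ARBITRARY MODEL FROM A COVER BY NODE CHARTS WITH KILL CERTIFICATES AND AGREEING TRACE FILTRATIONS

[OURS · L1 W4.5c · lead-1 g10; FRAME-STATUS rev10 §4 item 2, general form; the regular-model special case is `…S1aKillCertCover` (p639213)] — NOT
statements of the manuscript; counted 0; AI-level work, weaker than expert review. Crux stmt-ResolutionOfSingularities-17941 `CyclicQuotientFourfolds`, line
`s1a-logminvertex` v10, registered research stub `stub_killTouchReachAux`. Route-independent.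

On a general model the charts are NODES `(B_i, 𝒜_i, σ_i, e_i)` (tame root covers, `Γ(M.V, O_i) ≃ 𝒜_i 0`), the centres `f_i` live in `B_i`, and the chart
filtrations are the TRACES `(𝒥ₙ(f_i) ∩ 𝒜_i 0) ∘ e_i`. This file is the scheme-level K theorem in that generality: the agreement clause is stated on the
traces (FRAME-STATUS rev10 (F4): across different node rings it is a statement about the compatibility of the node covers, discharged by the user),
everything else is as in the regular case.

* ★★★ `GameFrame.GModel.exists_isPrincipalCentre_touch_of_nodeCertCover` — model `M` (Noetherian base, separated): finitely many stable affine charts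
  `O_i` with node data (tame node, `hσp`, intertwining `g₀`), weighted centres `(f_i, δ_i, w_i)` (K1′-regular, σ-adapted, homogeneous, `0 < c_i`) each with a
  COBORDANT KILL CERTIFICATE for every admissible `(hp, hσp)`, whose TRACE filtrations agree on every affine `U ≤ O_i ∩ O_j` (as extended ideals), and a
  closed non-empty `B ⊆ Z(M)` covered by the charts with `(zero set of the degree-1 trace on O_i) ∩ O_i ⊆ B` ⇒
  `∃ 𝒦 d, IsPrincipalCentre p M.act g₀ 𝒦 d ∧ (Z(M) ∩ supp 𝒦_d).Nonempty`.
-/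

set_option linter.dupNamespace false

noncomputable section

universe u v

open CategoryTheory Limits AlgebraicGeometry TopologicalSpace Topology Opposite
open Literature.AlgebraicGeometry.Resolution Literature.AlgebraicGeometry.RelativeSpec
open Summit.ResolutionOfSingularities.ResolutionOfSingularities.Theorems.WildQuotientResolution.S1
open Summit.ResolutionOfSingularities.ResolutionOfSingularities.Theorems.WildQuotientResolution.S1.NodeAtlas
open Summit.ResolutionOfSingularities.ResolutionOfSingularities.Theorems.WildQuotientResolution.S1.ProducerStep
open Summit.ResolutionOfSingularities.ResolutionOfSingularities.Theorems.WildQuotientResolution.S1.CoarseChart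
open Summit.ResolutionOfSingularities.ResolutionOfSingularities.Theorems.WildQuotientResolution.S1.ChartData
open Summit.ResolutionOfSingularities.ResolutionOfSingularities.Theorems.WildQuotientResolution.S1.KillGlue
open Summit.ResolutionOfSingularities.ResolutionOfSingularities.Theorems.WildQuotientResolution.S1.KillCert

namespace Summit.ResolutionOfSingularities.ResolutionOfSingularities.Theorems.WildQuotientResolution.S1.GameFrame.GModel

variable {p : ℕ} {X' X₁ : Scheme.{0}} {q : X' ⟶ X₁} {G : Type} [Group G] {ρ : G →* Aut X'} {g₀ : G}

/-- The zero set of the degree-`1` trace of a weighted centre with positive weights controls the zero set of every degree-`d` trace (`d ≥ 1`):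
`V(K_d) ⊆ V(K_1)` (since `K_1^d ≤ K_d`). [OURS · L1 W4.5c] -/
theorem zeroLocus_trace_subset (M : GModel p q G ρ g₀) (O : M.act.StableAffineOpens)
    {ι₀ : Type} [AddCommGroup ι₀] [DecidableEq ι₀] {B : Type} [CommRing B] (𝒜 : ι₀ → AddSubgroup B) [GradedRing 𝒜]
    (e : Γ(M.V, O.1) ≃+* ↥(𝒜 0)) {c : ℕ} (f : Fin c → B) (w : Fin c → ℕ) {d : ℕ} (hd : 0 < d) :
    M.V.zeroLocus (U := O.1) ((((traceFiltration 𝒜 f w).ideal d).comap (e : Γ(M.V, O.1) →+* ↥(𝒜 0)) : Ideal Γ(M.V, O.1)) : Set Γ(M.V, O.1)) ⊆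
      M.V.zeroLocus (U := O.1) ((((traceFiltration 𝒜 f w).ideal 1).comap (e : Γ(M.V, O.1) →+* ↥(𝒜 0)) : Ideal Γ(M.V, O.1)) : Set Γ(M.V, O.1)) := by
  intro x hx
  have hle : (((traceFiltration 𝒜 f w).ideal 1).comap (e : Γ(M.V, O.1) →+* ↥(𝒜 0))) ^ d ≤
      ((traceFiltration 𝒜 f w).ideal d).comap (e : Γ(M.V, O.1) →+* ↥(𝒜 0)) := by
    refine (Ideal.le_comap_pow _ d).trans (Ideal.comap_mono ?_)
    have := Veronese.idealFiltration_pow_le (traceFiltration 𝒜 f w) 1 d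
    rwa [one_mul] at this
  have h2 := M.V.zeroLocus_mono (SetLike.coe_subset_coe.mpr hle) hx
  rwa [← Scheme.zeroLocus_radical, Ideal.radical_pow _ hd.ne', Scheme.zeroLocus_radical] at h2

set_option maxHeartbeats 800000 in
/-- ★★★ **K AT AN ARBITRARY MODEL FROM A NODE-CERTIFICATE COVER WITH AGREEING TRACES.** Model `M` (Noetherian base, separated); finitely many stable affine
charts `O_i` with NODE data `(B_i, 𝒜_i, σ_i, e_i)` (tame node, `σ_i^[p] = id`, intertwining `g₀`), weighted centres `(f_i, δ_i, w_i)` in `B_i` (`0 < c_i`,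
homogeneous, positive weights, K1′-regular, σ-adapted), each with a COBORDANT KILL CERTIFICATE for every admissible `(hp, hσp)`; the TRACE filtrations
`(𝒥ₙ(f_i) ∩ 𝒜_i 0) ∘ e_i` agree on every affine `U ≤ O_i ∩ O_j` as extended ideals; `B ⊆ Z(M)` closed, non-empty, covered by the charts, containing the zero
sets of the degree-1 traces. Then some principal centre of `M` has support `B` meeting the bad locus — the conclusion of `KillTouchReachAux` at `M`.
[OURS · L1 W4.5c · FRAME-STATUS rev10 §4 (2) general form; NOT a statement of the manuscript] -/
theorem exists_isPrincipalCentre_touch_of_nodeCertCover [Finite G] (hp : p.Prime) (hG : ∀ g : G, g ∈ Subgroup.zpowers g₀)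
    (M : GModel p q G ρ g₀) (hNB : M.HasNoetherianBase) [M.V.IsSeparated]
    {ι : Type} [Finite ι] (O : ι → M.act.StableAffineOpens) (hO : ∀ i, IsAffineOpen (O i).1)
    (m : ι → ℕ) (r : ∀ i, Fin (m i) → ℕ) (B : ι → Type) [∀ i, CommRing (B i)]
    (𝒜 : ∀ i, (Π j : Fin (m i), ZMod (r i j)) → AddSubgroup (B i)) [∀ i, GradedRing (𝒜 i)] (σ : ∀ i, B i ≃+* B i)
    (e : ∀ i, Γ(M.V, (O i).1) ≃+* ↥(𝒜 i 0)) (htame : ∀ i, IsTameNode p (B i) (𝒜 i) (σ i))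
    (hσ : ∀ i (t : Γ(M.V, (O i).1)),
      ((e i ((M.act.aut g₀⁻¹).hom.appLE (O i).1 (O i).1 ((O i).2.1 g₀⁻¹).ge t) : ↥(𝒜 i 0)) : B i) = σ i ((e i t : ↥(𝒜 i 0)) : B i))
    (c : ι → ℕ) (f : ∀ i, Fin (c i) → B i) (δ : ∀ i, Fin (c i) → Π j : Fin (m i), ZMod (r i j)) (w : ∀ i, Fin (c i) → ℕ)
    (hc : ∀ i, 0 < c i) (hf : ∀ i k, f i k ∈ 𝒜 i (δ i k)) (hw : ∀ i k, 0 < w i k)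
    (hK1 : ∀ i, RingTheory.Sequence.IsRegular (B i) (List.ofFn (f i)))
    (hK1' : ∀ i, IsRegularRing (B i ⧸ Ideal.span (Set.range (f i))))
    (hσJ : ∀ i (n : ℕ), ((weightedFiltration (f i) (w i)).ideal n).map (σ i : B i →+* B i) ≤ (weightedFiltration (f i) (w i)).ideal n)
    (hcert : ∀ i (hp' : 0 < p) (hσp : ∀ x, (⇑(σ i))^[p] x = x), ∃ g, CobordantKillCert (f i) (w i) (σ i) (hσJ i) hp' hσp g)
    (hagree : ∀ i j (U : M.V.affineOpens) (hi : U.1 ≤ (O i).1) (hj : U.1 ≤ (O j).1) (n : ℕ),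
      (((traceFiltration (𝒜 i) (f i) (w i)).ideal n).comap (e i : Γ(M.V, (O i).1) →+* ↥(𝒜 i 0))).map
          (M.V.presheaf.map (homOfLE hi).op).hom =
        (((traceFiltration (𝒜 j) (f j) (w j)).ideal n).comap (e j : Γ(M.V, (O j).1) →+* ↥(𝒜 j 0))).map
          (M.V.presheaf.map (homOfLE hj).op).hom)
    {Bset : Set M.V} (hBc : IsClosed Bset) (hBbad : Bset ⊆ M.badLocus) (hBcov : Bset ⊆ ⋃ i, ((O i).1 : Set M.V)) (hBne : Bset.Nonempty)
    (hsupp : ∀ i, M.V.zeroLocus (U := (O i).1)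
        ((((traceFiltration (𝒜 i) (f i) (w i)).ideal 1).comap (e i : Γ(M.V, (O i).1) →+* ↥(𝒜 i 0)) : Ideal Γ(M.V, (O i).1)) :
          Set Γ(M.V, (O i).1)) ∩ ((O i).1 : Set M.V) ⊆ Bset) :
    ∃ (𝒦 : ReesFiltration M.V) (d : ℕ), IsPrincipalCentre p M.act g₀ 𝒦 d ∧ (M.badLocus ∩ ((𝒦.ideal d).support : Set M.V)).Nonempty := by
  classical
  haveI : IsLocallyNoetherian M.V := M.isLocallyNoetherian
  haveI : Fintype ι := Fintype.ofFinite ι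
  -- Veronese degrees from (T2) of the nodes, and a common one
  have hver₀ : ∀ i, ∃ d : ℕ, VeroneseNormalised (𝒜 i) (f i) (w i) d := fun i =>
    Veronese.veroneseNormalisation _ _ (𝒜 i) (htame i).2.2.2.1 (c i) (f i) (δ i) (w i) (hf i)
  choose d hd using hver₀
  let D : ℕ := ∏ i, d i
  have hdpos : ∀ i, 0 < d i := fun i => (hd i).1
  have hD : ∀ i, VeroneseNormalised (𝒜 i) (f i) (w i) D := by
    intro i
    have e1 : D = d i * ∏ j ∈ Finset.univ.erase i, d j := (Finset.mul_prod_erase Finset.univ d (Finset.mem_univ i)).symm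
    rw [e1]
    exact CoarseChart.veroneseNormalised_mul (𝒜 i) (f i) (w i) (hd i) (Finset.prod_pos fun j _ => hdpos j)
  have hDpos : 0 < D := Finset.prod_pos fun j _ => hdpos j
  -- the chart filtrations = traces
  let K : ∀ i, IdealFiltration Γ(M.V, (O i).1) := fun i =>
    (traceFiltration (𝒜 i) (f i) (w i)).comap (e i : Γ(M.V, (O i).1) →+* ↥(𝒜 i 0))
  let 𝒦 : ι → ReesFiltration M.V := fun i => chartFiltration (O i).1 (K i)
  have h𝒦O : ∀ i n, ((𝒦 i).filtration ⟨(O i).1, hO i⟩).ideal n =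
      ((traceFiltration (𝒜 i) (f i) (w i)).ideal n).comap (e i : Γ(M.V, (O i).1) →+* ↥(𝒜 i 0)) := fun i n =>
    filtration_chartFiltration (O i).1 (hO i) (K i) n
  have hprin : ∀ i, IsPrincipalCentreChart p M.act g₀ (𝒦 i) D (O i) := by
    intro i
    refine ⟨hO i, m i, r i, B i, inferInstance, 𝒜 i, inferInstance, σ i, e i, htame i, hσ i, c i, f i, δ i, w i, hc i, hf i, hw i, hK1 i, hK1' i,
      hσJ i, h𝒦O i, hD i, ?_⟩
    intro hp' hσp' d' b hb hσb hd'
    obtain ⟨g, hg⟩ := hcert i hp' hσp'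
    exact isPrincipal_augmentationIdeal_sigmaChart_of_cert (f i) (w i) _ (hσJ i) hp' hσp' (𝒜 i) hd' b hb hσb hg
  have hagree' : ∀ i j (U : M.V.affineOpens), U.1 ≤ (O i).1 → U.1 ≤ (O j).1 →
      ∀ n, ((𝒦 i).filtration U).ideal n = ((𝒦 j).filtration U).ideal n := by
    intro i j U hi hj n
    have ei : ((𝒦 i).filtration U).ideal n = (((traceFiltration (𝒜 i) (f i) (w i)).ideal n).comap
        (e i : Γ(M.V, (O i).1) →+* ↥(𝒜 i 0))).map (M.V.presheaf.map (homOfLE hi).op).hom := by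
      rw [← h𝒦O i n, ReesFiltration.filtration_ideal, ReesFiltration.filtration_ideal]
      exact (((𝒦 i).ideal n).map_ideal (U := U) (V := ⟨(O i).1, hO i⟩) hi).symm
    have ej : ((𝒦 j).filtration U).ideal n = (((traceFiltration (𝒜 j) (f j) (w j)).ideal n).comap
        (e j : Γ(M.V, (O j).1) →+* ↥(𝒜 j 0))).map (M.V.presheaf.map (homOfLE hj).op).hom := by
      rw [← h𝒦O j n, ReesFiltration.filtration_ideal, ReesFiltration.filtration_ideal]
      exact (((𝒦 j).ideal n).map_ideal (U := U) (V := ⟨(O j).1, hO j⟩) hj).symm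
    rw [ei, ej, hagree i j U hi hj n]
  have hsupp' : ∀ i, ((((𝒦 i).ideal D).support : Set M.V)) ∩ ((O i).1 : Set M.V) ⊆ Bset := by
    intro i x ⟨hx, hxO⟩
    have hZ : x ∈ M.V.zeroLocus (U := (O i).1) (((K i).ideal D : Ideal Γ(M.V, (O i).1)) : Set Γ(M.V, (O i).1)) :=
      (mem_support_chartFiltration_iff (O i).1 (hO i) (K i) D hxO).mp hx
    exact hsupp i ⟨zeroLocus_trace_subset M (O i) (𝒜 i) (e i) (f i) (w i) hDpos hZ, hxO⟩
  obtain ⟨J, hJ, hJsupp, -⟩ := exists_isPrincipalCentre_of_agree hp hG M hNB O 𝒦 hDpos hprin hagree' hBc hBbad hBcov hsupp'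
  obtain ⟨v, hv⟩ := hBne
  exact ⟨J, D, hJ, v, hBbad hv, by rw [hJsupp]; exact hv⟩

set_option maxHeartbeats 800000 in
/-- ★★ **THE PRINCIPAL CENTRE OF A NODE-CERTIFICATE COVER, WITH ITS SUPPORT** (v2): same hypotheses as
`exists_isPrincipalCentre_touch_of_nodeCertCover` WITHOUT non-emptiness of `B`; conclusion: a principal centre of `M` whose degree-`d` support IS `B` and for
which every `O_i` is a principal-centre chart. (So the K-conclusion holds as soon as `B` meets `Z(M)`; and when `Z(M) ⊆ B` the move along it leaves no bad
point of `M` uncovered.) [OURS · L1 W4.5c; NOT a statement of the manuscript] -/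
theorem exists_isPrincipalCentre_support_eq_of_nodeCertCover [Finite G] (hp : p.Prime) (hG : ∀ g : G, g ∈ Subgroup.zpowers g₀)
    (M : GModel p q G ρ g₀) (hNB : M.HasNoetherianBase) [M.V.IsSeparated]
    {ι : Type} [Finite ι] (O : ι → M.act.StableAffineOpens) (hO : ∀ i, IsAffineOpen (O i).1)
    (m : ι → ℕ) (r : ∀ i, Fin (m i) → ℕ) (B : ι → Type) [∀ i, CommRing (B i)]
    (𝒜 : ∀ i, (Π j : Fin (m i), ZMod (r i j)) → AddSubgroup (B i)) [∀ i, GradedRing (𝒜 i)] (σ : ∀ i, B i ≃+* B i)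
    (e : ∀ i, Γ(M.V, (O i).1) ≃+* ↥(𝒜 i 0)) (htame : ∀ i, IsTameNode p (B i) (𝒜 i) (σ i))
    (hσ : ∀ i (t : Γ(M.V, (O i).1)),
      ((e i ((M.act.aut g₀⁻¹).hom.appLE (O i).1 (O i).1 ((O i).2.1 g₀⁻¹).ge t) : ↥(𝒜 i 0)) : B i) = σ i ((e i t : ↥(𝒜 i 0)) : B i))
    (c : ι → ℕ) (f : ∀ i, Fin (c i) → B i) (δ : ∀ i, Fin (c i) → Π j : Fin (m i), ZMod (r i j)) (w : ∀ i, Fin (c i) → ℕ)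
    (hc : ∀ i, 0 < c i) (hf : ∀ i k, f i k ∈ 𝒜 i (δ i k)) (hw : ∀ i k, 0 < w i k)
    (hK1 : ∀ i, RingTheory.Sequence.IsRegular (B i) (List.ofFn (f i)))
    (hK1' : ∀ i, IsRegularRing (B i ⧸ Ideal.span (Set.range (f i))))
    (hσJ : ∀ i (n : ℕ), ((weightedFiltration (f i) (w i)).ideal n).map (σ i : B i →+* B i) ≤ (weightedFiltration (f i) (w i)).ideal n)
    (hcert : ∀ i (hp' : 0 < p) (hσp : ∀ x, (⇑(σ i))^[p] x = x), ∃ g, CobordantKillCert (f i) (w i) (σ i) (hσJ i) hp' hσp g)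
    (hagree : ∀ i j (U : M.V.affineOpens) (hi : U.1 ≤ (O i).1) (hj : U.1 ≤ (O j).1) (n : ℕ),
      (((traceFiltration (𝒜 i) (f i) (w i)).ideal n).comap (e i : Γ(M.V, (O i).1) →+* ↥(𝒜 i 0))).map
          (M.V.presheaf.map (homOfLE hi).op).hom =
        (((traceFiltration (𝒜 j) (f j) (w j)).ideal n).comap (e j : Γ(M.V, (O j).1) →+* ↥(𝒜 j 0))).map
          (M.V.presheaf.map (homOfLE hj).op).hom)
    {Bset : Set M.V} (hBc : IsClosed Bset) (hBbad : Bset ⊆ M.badLocus) (hBcov : Bset ⊆ ⋃ i, ((O i).1 : Set M.V))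
    (hsupp : ∀ i, M.V.zeroLocus (U := (O i).1)
        ((((traceFiltration (𝒜 i) (f i) (w i)).ideal 1).comap (e i : Γ(M.V, (O i).1) →+* ↥(𝒜 i 0)) : Ideal Γ(M.V, (O i).1)) :
          Set Γ(M.V, (O i).1)) ∩ ((O i).1 : Set M.V) ⊆ Bset) :
    ∃ (𝒦 : ReesFiltration M.V) (d : ℕ), IsPrincipalCentre p M.act g₀ 𝒦 d ∧ (((𝒦.ideal d).support : Set M.V)) = Bset ∧
      ∀ i, IsPrincipalCentreChart p M.act g₀ 𝒦 d (O i) := by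
  classical
  haveI : IsLocallyNoetherian M.V := M.isLocallyNoetherian
  haveI : Fintype ι := Fintype.ofFinite ι
  -- Veronese degrees from (T2) of the nodes, and a common one
  have hver₀ : ∀ i, ∃ d : ℕ, VeroneseNormalised (𝒜 i) (f i) (w i) d := fun i =>
    Veronese.veroneseNormalisation _ _ (𝒜 i) (htame i).2.2.2.1 (c i) (f i) (δ i) (w i) (hf i)
  choose d hd using hver₀
  let D : ℕ := ∏ i, d i
  have hdpos : ∀ i, 0 < d i := fun i => (hd i).1
  have hD : ∀ i, VeroneseNormalised (𝒜 i) (f i) (w i) D := by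
    intro i
    have e1 : D = d i * ∏ j ∈ Finset.univ.erase i, d j := (Finset.mul_prod_erase Finset.univ d (Finset.mem_univ i)).symm
    rw [e1]
    exact CoarseChart.veroneseNormalised_mul (𝒜 i) (f i) (w i) (hd i) (Finset.prod_pos fun j _ => hdpos j)
  have hDpos : 0 < D := Finset.prod_pos fun j _ => hdpos j
  -- the chart filtrations = traces
  let K : ∀ i, IdealFiltration Γ(M.V, (O i).1) := fun i =>
    (traceFiltration (𝒜 i) (f i) (w i)).comap (e i : Γ(M.V, (O i).1) →+* ↥(𝒜 i 0))
  let 𝒦 : ι → ReesFiltration M.V := fun i => chartFiltration (O i).1 (K i)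
  have h𝒦O : ∀ i n, ((𝒦 i).filtration ⟨(O i).1, hO i⟩).ideal n =
      ((traceFiltration (𝒜 i) (f i) (w i)).ideal n).comap (e i : Γ(M.V, (O i).1) →+* ↥(𝒜 i 0)) := fun i n =>
    filtration_chartFiltration (O i).1 (hO i) (K i) n
  have hprin : ∀ i, IsPrincipalCentreChart p M.act g₀ (𝒦 i) D (O i) := by
    intro i
    refine ⟨hO i, m i, r i, B i, inferInstance, 𝒜 i, inferInstance, σ i, e i, htame i, hσ i, c i, f i, δ i, w i, hc i, hf i, hw i, hK1 i, hK1' i,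
      hσJ i, h𝒦O i, hD i, ?_⟩
    intro hp' hσp' d' b hb hσb hd'
    obtain ⟨g, hg⟩ := hcert i hp' hσp'
    exact isPrincipal_augmentationIdeal_sigmaChart_of_cert (f i) (w i) _ (hσJ i) hp' hσp' (𝒜 i) hd' b hb hσb hg
  have hagree' : ∀ i j (U : M.V.affineOpens), U.1 ≤ (O i).1 → U.1 ≤ (O j).1 →
      ∀ n, ((𝒦 i).filtration U).ideal n = ((𝒦 j).filtration U).ideal n := by
    intro i j U hi hj n
    have ei : ((𝒦 i).filtration U).ideal n = (((traceFiltration (𝒜 i) (f i) (w i)).ideal n).comap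
        (e i : Γ(M.V, (O i).1) →+* ↥(𝒜 i 0))).map (M.V.presheaf.map (homOfLE hi).op).hom := by
      rw [← h𝒦O i n, ReesFiltration.filtration_ideal, ReesFiltration.filtration_ideal]
      exact (((𝒦 i).ideal n).map_ideal (U := U) (V := ⟨(O i).1, hO i⟩) hi).symm
    have ej : ((𝒦 j).filtration U).ideal n = (((traceFiltration (𝒜 j) (f j) (w j)).ideal n).comap
        (e j : Γ(M.V, (O j).1) →+* ↥(𝒜 j 0))).map (M.V.presheaf.map (homOfLE hj).op).hom := by
      rw [← h𝒦O j n, ReesFiltration.filtration_ideal, ReesFiltration.filtration_ideal]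
      exact (((𝒦 j).ideal n).map_ideal (U := U) (V := ⟨(O j).1, hO j⟩) hj).symm
    rw [ei, ej, hagree i j U hi hj n]
  have hsupp' : ∀ i, ((((𝒦 i).ideal D).support : Set M.V)) ∩ ((O i).1 : Set M.V) ⊆ Bset := by
    intro i x ⟨hx, hxO⟩
    have hZ : x ∈ M.V.zeroLocus (U := (O i).1) (((K i).ideal D : Ideal Γ(M.V, (O i).1)) : Set Γ(M.V, (O i).1)) :=
      (mem_support_chartFiltration_iff (O i).1 (hO i) (K i) D hxO).mp hx
    exact hsupp i ⟨zeroLocus_trace_subset M (O i) (𝒜 i) (e i) (f i) (w i) hDpos hZ, hxO⟩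
  obtain ⟨J, hJ, hJsupp, hJO⟩ := exists_isPrincipalCentre_of_agree hp hG M hNB O 𝒦 hDpos hprin hagree' hBc hBbad hBcov hsupp'
  exact ⟨J, D, hJ, hJsupp, hJO⟩

end Summit.ResolutionOfSingularities.ResolutionOfSingularities.Theorems.WildQuotientResolution.S1.GameFrame.GModel

end
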